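import Summits.AnomalousDissipation.AnomalousDissipation.Theorems.SawtoothPulseCascadeApproxRealign
import Summits.AnomalousDissipation.AnomalousDissipation.Theorems.SawtoothPulseCascadeK2ParallelHalfPulse
import Literature.Analysis.FunctionSpaces.TorusDiffMonomialBounds
import Literature.Analysis.FunctionSpaces.TorusLerayHelmholtz

/-!
# One half-slot of the forced linearised response: split, size of the slot part, realigned end value
(route `AnomalousDissipation/SawtoothPulseCascade`; helper for the crux ApproxSol58 =
stmt-AnomalousDissipation-19688, registered stub `stub_responseL2` / S1 `stub_responseL2Envelope`:
the realignment pipeline, the Duhamel step)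

Let `(L, q)` be a classical solution of the heat-lag-FORCED linearised equations on `[0, T']` and consider
the H half-slot `[a, b] = [tStart j, tStart j + tHalf j] ⊆ [0, T']` (resp. the V half-slot).  Given a
classical HOMOGENEOUS solution `S` on the slot with `S(a) = L(a)` ("what entered the slot"):

* §1 `L²` triangle inequalities on `𝕋²` (`√∫‖v + w‖² ≤ √∫‖v‖² + √∫‖w‖²`, finite sums) and the size of a
  parallel profile field;
* §2 SPLIT: `L(t) = S(t) + F(t, x₂) e₁` on the slot, `F` the forced parallel heat profile from zero
  (`K2Classical.exists_heatProfile_forced` + uniqueness `Torus.linearisedNS_unique`), with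
  `√∫‖L(t) − S(t)‖² ≤ 6√(2π) ν N_j γ / δ_j` (`…ApproxForcedProfile`);
* §3 END VALUE: if moreover `W` is a classical homogeneous solution on the slot started from the
  realigned comb profile `g` of `…ApproxRealign` (`W(a) = g(x₂) e₁`), then `L(b) = S(b) + W(b)`
  (`K2Classical.parallel_H_unique` + the realignment identity).
-/

set_option linter.dupNamespace false

noncomputable section

namespace Summit.AnomalousDissipation.AnomalousDissipation.Theorems.SawtoothPulseCascade.ApproxResponse

open Set MeasureTheory
open scoped ContDiff InnerProductSpace
open Literature.Analysis Literature.Analysis.FunctionSpaces Literature.Analysis.FluidPDE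
open Literature.Analysis.FluidPDE.SawtoothCascade
open Literature.Analysis.FluidPDE.SawtoothCascade.CascadeParams
open Summit.AnomalousDissipation.AnomalousDissipation.Theorems.SawtoothPulseCascade.K2Classical

/-! ## §1 `L²` bookkeeping on `𝕋²` -/

/-- **Triangle inequality** for `√∫‖·‖²` of continuous fields. -/
theorem sqrt_vectorL2Sq_add_le {v w : UnitAddTorus (Fin 2) → EuclideanSpace ℝ (Fin 2)}
    (hv : Continuous v) (hw : Continuous w) :
    Real.sqrt (Torus.vectorL2Sq (fun x => v x + w x)) ≤
      Real.sqrt (Torus.vectorL2Sq v) + Real.sqrt (Torus.vectorL2Sq w) := by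
  unfold Torus.vectorL2Sq
  have hA0 : 0 ≤ ∫ x, ‖v x‖ ^ 2 := integral_nonneg fun x => by positivity
  have hB0 : 0 ≤ ∫ x, ‖w x‖ ^ 2 := integral_nonneg fun x => by positivity
  have hcs : ∫ x, ‖v x‖ * ‖w x‖ ≤ Real.sqrt (∫ x, ‖v x‖ ^ 2) * Real.sqrt (∫ x, ‖w x‖ ^ 2) :=
    Torus.integral_mul_le_sqrt_mul_sqrt hv.norm hw.norm
  have hpt : ∀ x, ‖v x + w x‖ ^ 2 ≤ ‖v x‖ ^ 2 + 2 * (‖v x‖ * ‖w x‖) + ‖w x‖ ^ 2 := by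
    intro x
    have h := norm_add_le (v x) (w x)
    have h0 : 0 ≤ ‖v x + w x‖ := norm_nonneg _
    nlinarith [norm_nonneg (v x), norm_nonneg (w x)]
  have hi1 : Integrable (fun x => ‖v x‖ ^ 2) volume := (hv.norm.pow 2).integrable_unitAddTorus
  have hi2 : Integrable (fun x => ‖w x‖ ^ 2) volume := (hw.norm.pow 2).integrable_unitAddTorus
  have hi3 : Integrable (fun x => ‖v x‖ * ‖w x‖) volume := (hv.norm.mul hw.norm).integrable_unitAddTorus
  have hi3' : Integrable (fun x => 2 * (‖v x‖ * ‖w x‖)) volume := hi3.const_mul 2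
  have hi12 : Integrable (fun x => ‖v x‖ ^ 2 + 2 * (‖v x‖ * ‖w x‖)) volume := hi1.add hi3'
  have hi123 : Integrable (fun x => ‖v x‖ ^ 2 + 2 * (‖v x‖ * ‖w x‖) + ‖w x‖ ^ 2) volume := hi12.add hi2
  have e1 : ∫ x, (‖v x‖ ^ 2 + 2 * (‖v x‖ * ‖w x‖) + ‖w x‖ ^ 2) =
      (∫ x, ‖v x‖ ^ 2) + 2 * (∫ x, ‖v x‖ * ‖w x‖) + ∫ x, ‖w x‖ ^ 2 := by
    rw [integral_add hi12 hi2, integral_add hi1 hi3', integral_const_mul]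
  have hle0 : ∫ x, ‖v x + w x‖ ^ 2 ≤ ∫ x, (‖v x‖ ^ 2 + 2 * (‖v x‖ * ‖w x‖) + ‖w x‖ ^ 2) :=
    integral_mono ((hv.add hw).norm.pow 2).integrable_unitAddTorus hi123 hpt
  rw [e1] at hle0
  have hle : ∫ x, ‖v x + w x‖ ^ 2 ≤ (Real.sqrt (∫ x, ‖v x‖ ^ 2) + Real.sqrt (∫ x, ‖w x‖ ^ 2)) ^ 2 := by
    nlinarith [Real.sq_sqrt hA0, Real.sq_sqrt hB0, hcs, hle0]
  exact Real.sqrt_le_iff.2 ⟨by positivity, hle⟩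

/-- Triangle inequality for finite sums of continuous fields. -/
theorem sqrt_vectorL2Sq_sum_le {ι : Type*} (s : Finset ι)
    {v : ι → UnitAddTorus (Fin 2) → EuclideanSpace ℝ (Fin 2)} (hv : ∀ i ∈ s, Continuous (v i)) :
    Real.sqrt (Torus.vectorL2Sq (fun x => ∑ i ∈ s, v i x)) ≤ ∑ i ∈ s, Real.sqrt (Torus.vectorL2Sq (v i)) := by
  classical
  induction s using Finset.induction_on with
  | empty => simp [Torus.vectorL2Sq]
  | insert a s ha ih =>
    have hva : Continuous (v a) := hv a (Finset.mem_insert_self a s)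
    have hvs : ∀ i ∈ s, Continuous (v i) := fun i hi => hv i (Finset.mem_insert_of_mem hi)
    have hsc : Continuous (fun x => ∑ i ∈ s, v i x) := continuous_finsetSum s fun i hi => hvs i hi
    rw [Finset.sum_insert ha]
    simp_rw [Finset.sum_insert ha]
    exact (sqrt_vectorL2Sq_add_le hva hsc).trans (by linarith [ih hvs])

/-- A parallel profile field `x ↦ F(x_k) e_m` with `|F| ≤ B` has `√∫‖·‖² ≤ B`. -/
theorem sqrt_vectorL2Sq_parallel_le {F : ℝ → ℝ} {B : ℝ} (hB : 0 ≤ B) (hF : ∀ y, |F y| ≤ B) (k m : Fin 2) :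
    Real.sqrt (Torus.vectorL2Sq (fun x : UnitAddTorus (Fin 2) =>
      F (Torus.repr x k) • EuclideanSpace.single m (1 : ℝ))) ≤ B := by
  unfold Torus.vectorL2Sq
  have hpt : ∀ x : UnitAddTorus (Fin 2), ‖F (Torus.repr x k) • EuclideanSpace.single m (1 : ℝ)‖ ^ 2 ≤ B ^ 2 := by
    intro x
    rw [norm_smul, PiLp.norm_single, norm_one, mul_one, Real.norm_eq_abs]
    exact pow_le_pow_left₀ (abs_nonneg _) (hF _) 2
  have hle : ∫ x : UnitAddTorus (Fin 2), ‖F (Torus.repr x k) • EuclideanSpace.single m (1 : ℝ)‖ ^ 2 ≤ B ^ 2 := by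
    calc ∫ x : UnitAddTorus (Fin 2), ‖F (Torus.repr x k) • EuclideanSpace.single m (1 : ℝ)‖ ^ 2
        ≤ ∫ _ : UnitAddTorus (Fin 2), B ^ 2 := by
          refine integral_mono_of_nonneg (ae_of_all _ fun x => by positivity) (integrable_const _)
            (ae_of_all _ hpt)
      _ = B ^ 2 := by simp
  calc Real.sqrt (∫ x : UnitAddTorus (Fin 2), ‖F (Torus.repr x k) • EuclideanSpace.single m (1 : ℝ)‖ ^ 2)
      ≤ Real.sqrt (B ^ 2) := Real.sqrt_le_sqrt hle
    _ = B := Real.sqrt_sq hB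


/-- The one-sided time derivative within a non-degenerate sub-interval agrees with the one within the
larger interval (for jointly smooth fields). -/
theorem timeDerivWithin_Icc_eq_of_subset {a b a' b' : ℝ} (hlt : a' < b')
    (hsub : Icc a' b' ⊆ Icc a b) {w : ℝ → UnitAddTorus (Fin 2) → EuclideanSpace ℝ (Fin 2)}
    (hw : Torus.IsSmoothSpaceTimeOn (Icc a b) w) {t : ℝ} (ht : t ∈ Icc a' b')
    (x : UnitAddTorus (Fin 2)) :
    Torus.timeDerivWithin (Icc a' b') w t x = Torus.timeDerivWithin (Icc a b) w t x :=
  ((hw.hasDerivWithinAt_slice (hsub ht) x).mono hsub).derivWithin (uniqueDiffOn_Icc hlt t ht)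

/-- The heat-lag source profile `(t, y) ↦ ν rateX(t) U_j''(y)` is jointly smooth (any smooth rate). -/
theorem contDiffOn_lagSource (P : CascadeParams) {j : ℕ} (hδ : 0 < P.δ j) (ν : ℝ) {r : ℝ → ℝ}
    (hr : ContDiff ℝ ∞ r) (S : Set ℝ) :
    ContDiffOn ℝ ∞ (Function.uncurry fun t y => ν * (r t * deriv (deriv (P.U j)) y)) (S ×ˢ univ) := by
  have hU'' : ContDiff ℝ ∞ (deriv (deriv (P.U j))) := by
    simpa using (P.contDiff_U hδ (n := ∞)).iterate_deriv 2
  exact (contDiff_const.mul ((hr.comp contDiff_fst).mul (hU''.comp contDiff_snd))).contDiffOn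

/-- `U_j''` is `1`-periodic. -/
theorem periodic_deriv_deriv_U (P : CascadeParams) (j : ℕ) : Function.Periodic (deriv (deriv (P.U j))) 1 :=
  ShearCascade.periodic_deriv (ShearCascade.periodic_deriv (P.U_periodic j))

/-! ## §2 The split on the H half-slot -/

/-- **Split of the forced response on the H half-slot of phase `j`.**  For `δ₀ > 0`, `d > 0`, `γ ≥ 0`,
`N_j ≠ 0`, `ν > 0`: let `(L, q)` solve the heat-lag-forced linearised equations classically on
`[0, T'] ⊇ [tStart j, tStart j + tHalf j]` and let `(S, Q)` be a classical homogeneous solution on the slot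
with `L(tStart j) = S(tStart j)`.  Then `L = S + F(·, x₂) e₁` on the slot, `F` the forced parallel heat
profile from zero (`∂ₜ|_slot F = ν F'' + ν rateH_j U_j''`), and `√∫‖L(t) − S(t)‖² ≤ 6√(2π) ν N_j γ / δ_j`. -/
theorem slot_split_H (P : CascadeParams) (hδ₀ : 0 < P.δ₀) (hd : 0 < P.d) (hγ : 0 ≤ P.γ) {j : ℕ}
    (hN : P.N j ≠ 0) {ν : ℝ} (hν : 0 < ν) {T' : ℝ} (hT' : tStart j + tHalf j ≤ T')
    {L : ℝ → UnitAddTorus (Fin 2) → EuclideanSpace ℝ (Fin 2)} {q : ℝ → UnitAddTorus (Fin 2) → ℝ}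
    (hL : Torus.IsSmoothSpaceTimeOn (Icc 0 T') L) (hq : Torus.IsSmoothSpaceTimeOn (Icc 0 T') q)
    (hlin : ∀ t ∈ Icc 0 T', ∀ x, Torus.timeDerivWithin (Icc 0 T') L t x + Torus.convect (P.field t) (L t) x +
      Torus.convect (L t) (P.field t) x =
        ν • Torus.laplacian (L t) x - Torus.gradient (q t) x + ν • Torus.laplacian (P.field t) x)
    {S : ℝ → UnitAddTorus (Fin 2) → EuclideanSpace ℝ (Fin 2)} {Q : ℝ → UnitAddTorus (Fin 2) → ℝ}
    (hS : Torus.IsSmoothSpaceTimeOn (Icc (tStart j) (tStart j + tHalf j)) S)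
    (hQ : Torus.IsSmoothSpaceTimeOn (Icc (tStart j) (tStart j + tHalf j)) Q)
    (hSdiv : ∀ t ∈ Icc (tStart j) (tStart j + tHalf j), Torus.IsDivFree (S t))
    (hSlin : ∀ t ∈ Icc (tStart j) (tStart j + tHalf j), ∀ x,
      Torus.timeDerivWithin (Icc (tStart j) (tStart j + tHalf j)) S t x + Torus.convect (P.field t) (S t) x +
        Torus.convect (S t) (P.field t) x = ν • Torus.laplacian (S t) x - Torus.gradient (Q t) x)
    (hLdiv : ∀ t ∈ Icc 0 T', Torus.IsDivFree (L t))
    (h0 : L (tStart j) = S (tStart j)) :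
    ∃ F : ℝ → ℝ → ℝ, ContDiffOn ℝ ∞ (Function.uncurry F) (Icc (tStart j) (tStart j + tHalf j) ×ˢ univ) ∧
      (∀ t ∈ Icc (tStart j) (tStart j + tHalf j), Function.Periodic (F t) 1) ∧ F (tStart j) = (fun _ => 0) ∧
      (∀ t ∈ Icc (tStart j) (tStart j + tHalf j), ∀ y,
        derivWithin (fun s => F s y) (Icc (tStart j) (tStart j + tHalf j)) t =
          ν * deriv (deriv (F t)) y + ν * (P.rateH j t * deriv (deriv (P.U j)) y)) ∧
      (∀ t ∈ Icc (tStart j) (tStart j + tHalf j),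
        L t = fun x => S t x + F t (Torus.repr x 1) • EuclideanSpace.single (0 : Fin 2) (1 : ℝ)) ∧
      (∀ t ∈ Icc (tStart j) (tStart j + tHalf j),
        Real.sqrt (Torus.vectorL2Sq (fun x => L t x - S t x)) ≤
          6 * Real.sqrt (2 * Real.pi) * ν * (P.N j) * P.γ / P.δ j) := by
  have hlt : tStart j < tStart j + tHalf j := by linarith [tHalf_pos j]
  have hδ := P.δ_pos hδ₀ hd j
  have hsub : Icc (tStart j) (tStart j + tHalf j) ⊆ Icc 0 T' := fun s hs => ⟨(tStart_nonneg j).trans hs.1, hs.2.trans hT'⟩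
  have hsub1 : Icc (tStart j) (tStart j + tHalf j) ⊆ Ico (0 : ℝ) 1 :=
    fun s hs => ⟨(tStart_nonneg j).trans hs.1, lt_of_le_of_lt hs.2 (tStart_add_tHalf_lt_one j)⟩
  have hfield : Torus.IsSmoothSpaceTimeOn (Icc (tStart j) (tStart j + tHalf j)) P.field :=
    (cascadeFieldSmooth P hδ₀ hd).mono hsub1
  -- the forced parallel profile from zero
  obtain ⟨F, hF, hFper, heatF, hF0⟩ := exists_heatProfile_forced hlt hν (g := fun _ : ℝ => (0 : ℝ))
    contDiff_const (fun _ => rfl) (σ := fun t y => ν * (P.rateH j t * deriv (deriv (P.U j)) y))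
    (contDiffOn_lagSource P hδ ν (P.contDiff_rateH j) _)
    (fun t _ y => by simp only [(periodic_deriv_deriv_U P j) y])
  set Φ : ℝ → UnitAddTorus (Fin 2) → EuclideanSpace ℝ (Fin 2) :=
    fun t x => F t (Torus.repr x 1) • EuclideanSpace.single (0 : Fin 2) (1 : ℝ) with hΦ_def
  have hΦs : Torus.IsSmoothSpaceTimeOn (Icc (tStart j) (tStart j + tHalf j)) Φ :=
    isSmoothSpaceTimeOn_parallelShear hF hFper
  have hΦdiv : ∀ t ∈ Icc (tStart j) (tStart j + tHalf j), Torus.IsDivFree (Φ t) :=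
    fun t ht => isDivFree_parallelShear (k := 1) (m := 0) (by decide) (hFper t ht)
  have h0s : Torus.IsSmoothSpaceTimeOn (Icc (tStart j) (tStart j + tHalf j))
      (fun (_ : ℝ) (_ : UnitAddTorus (Fin 2)) => (0 : ℝ)) :=
    Torus.isSmoothSpaceTimeOn_const (Torus.isSmooth_const (0 : ℝ)) _
  have hΦlin : ∀ t ∈ Icc (tStart j) (tStart j + tHalf j), ∀ x,
      Torus.timeDerivWithin (Icc (tStart j) (tStart j + tHalf j)) Φ t x + Torus.convect (P.field t) (Φ t) x +
        Torus.convect (Φ t) (P.field t) x =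
          ν • Torus.laplacian (Φ t) x - Torus.gradient (fun _ : UnitAddTorus (Fin 2) => (0 : ℝ)) x +
            ν • Torus.laplacian (P.field t) x := by
    intro t ht x
    simp only [hΦ_def]
    rw [linearisedNSForced_parallelShear (k := 1) (m := 0) (by decide) (uniqueDiffOn_Icc hlt) (u := P.field)
      (c := fun t y => P.rateH j t * P.U j y) (fun _ hs => field_eq_parallel_H P hs)
      (fun t _ y => by simp only [P.U_periodic j y])
      (fun _ _ => contDiff_const.mul (P.contDiff_U hδ)) hF hFper heatF t ht x,
      laplacian_field_of_mem_H P hδ₀ hd ht x, smul_smul]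
  -- `L` restricted to the slot
  have hLs := hL.mono hsub
  have hqs := hq.mono hsub
  have hlin' : ∀ t ∈ Icc (tStart j) (tStart j + tHalf j), ∀ x,
      Torus.timeDerivWithin (Icc (tStart j) (tStart j + tHalf j)) L t x + Torus.convect (P.field t) (L t) x +
        Torus.convect (L t) (P.field t) x =
          ν • Torus.laplacian (L t) x - Torus.gradient (q t) x + ν • Torus.laplacian (P.field t) x := by
    intro t ht x
    rw [timeDerivWithin_Icc_eq_of_subset hlt hsub hL ht x]
    exact hlin t (hsub ht) x
  -- the difference `L − Φ` solves the homogeneous equations with datum `S(tStart j)`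
  have hDlin : ∀ t ∈ Icc (tStart j) (tStart j + tHalf j), ∀ x,
      Torus.timeDerivWithin (Icc (tStart j) (tStart j + tHalf j)) (fun s y => L s y - Φ s y) t x +
        Torus.convect (P.field t) (fun y => L t y - Φ t y) x + Torus.convect (fun y => L t y - Φ t y) (P.field t) x =
          ν • Torus.laplacian (fun y => L t y - Φ t y) x -
            Torus.gradient (fun y => q t y - (fun (_ : ℝ) (_ : UnitAddTorus (Fin 2)) => (0 : ℝ)) t y) x := by
    intro t ht x
    have h := Torus.linearisedNSForced_sub_eq hLs hqs hlin' hΦs h0s hΦlin hlt ht x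
    rw [sub_self, add_zero] at h
    exact h
  have hDs : Torus.IsSmoothSpaceTimeOn (Icc (tStart j) (tStart j + tHalf j)) (fun s y => L s y - Φ s y) := hLs.sub hΦs
  have hDq : Torus.IsSmoothSpaceTimeOn (Icc (tStart j) (tStart j + tHalf j))
      (fun s y => q s y - (fun (_ : ℝ) (_ : UnitAddTorus (Fin 2)) => (0 : ℝ)) s y) := hqs.sub h0s
  have hDdiv : ∀ t ∈ Icc (tStart j) (tStart j + tHalf j), Torus.IsDivFree (fun y => L t y - Φ t y) := by
    intro t ht x
    have h12 : (fun y => L t y - Φ t y) = L t - Φ t := rfl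
    rw [h12, Torus.divergence_sub ((hLs.isSmooth_slice ht).isContDiff (by simp))
      ((hΦs.isSmooth_slice ht).isContDiff (by simp)), hLdiv t (hsub ht) x, hΦdiv t ht x, sub_zero]
  have ha : tStart j ∈ Icc (tStart j) (tStart j + tHalf j) := left_mem_Icc.2 hlt.le
  have hD0 : (fun y => L (tStart j) y - Φ (tStart j) y) = S (tStart j) := by
    funext y
    simp only [hΦ_def, hF0, zero_smul, sub_zero, h0]
  have huniq : ∀ t ∈ Icc (tStart j) (tStart j + tHalf j), (fun y => L t y - Φ t y) = S t := fun t ht =>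
    Torus.linearisedNS_unique hν.le hfield (fun s hs => P.isDivFree_field_of_mem_H hs) hDs hDq hDdiv hDlin
      hS hQ hSdiv hSlin hD0 ht
  -- size of the slot part
  have hbound : ∀ t ∈ Icc (tStart j) (tStart j + tHalf j), ∀ y,
      |F t y| ≤ 6 * Real.sqrt (2 * Real.pi) * ν * (P.N j) * P.γ / P.δ j := by
    intro t ht y
    have heat' : ∀ s ∈ Icc (tStart j) (tStart j + tHalf j), ∀ z,
        derivWithin (fun τ => F τ z) (Icc (tStart j) (tStart j + tHalf j)) s =
          ν * deriv (deriv (F s)) z + P.rateH j s * (ν * deriv (deriv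
            (fun y : ℝ => roundedSaw (P.δ j) (2 * Real.pi * (P.N j : ℕ) * y) / (2 * Real.pi * (P.N j : ℕ)))) z) := by
      intro s hs z
      rw [heatF s hs z, cascade_U_eq]
      ring
    have h := abs_forcedProfile_le hδ hN (by linarith : tStart j < tStart j + tHalf j) hν.le hF hFper hF0
      (P.contDiff_rateH j) heat' ht y
    rw [abs_of_pos hν] at h
    have hI : (∫ s in tStart j..t, |P.rateH j s|) ≤ P.γ := by
      rw [← integral_abs_rateH P hγ j]
      exact intervalIntegral.integral_mono_interval le_rfl ht.1 ht.2
        (ae_of_all _ fun s => abs_nonneg _) ((P.continuous_rateH j).abs.intervalIntegrable _ _)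
    have hK : 0 ≤ 6 * Real.sqrt (2 * Real.pi) * ν * (P.N j : ℝ) := by positivity
    calc |F t y| ≤ 6 * Real.sqrt (2 * Real.pi) * ν * (P.N j) * (∫ s in tStart j..t, |P.rateH j s|) / P.δ j := h
      _ ≤ 6 * Real.sqrt (2 * Real.pi) * ν * (P.N j) * P.γ / P.δ j := by
          gcongr
  refine ⟨F, hF, hFper, hF0, heatF, fun t ht => ?_, fun t ht => ?_⟩
  · funext x
    have := congrFun (huniq t ht) x
    rw [← this]
    simp only [hΦ_def, sub_add_cancel]
  · have hEq : (fun x => L t x - S t x) = Φ t := by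
      funext x
      have := congrFun (huniq t ht) x
      rw [← this]
      simp only [hΦ_def]
      abel
    rw [hEq]
    exact sqrt_vectorL2Sq_parallel_le (by positivity) (hbound t ht) 1 0

/-! ## §3 The realigned end value on the H half-slot -/

/-- **End value on the H half-slot.**  With `F` the forced parallel profile of `slot_split_H` and `W` a
classical homogeneous solution on the slot started from the realigned comb profile `g` of
`exists_realigned_H` (`W(tStart j) = g(x₂) e₁`): `W(tStart j + tHalf j) = F(tStart j + tHalf j, x₂) e₁`. -/
theorem slot_end_H (P : CascadeParams) (hδ₀ : 0 < P.δ₀) (hd : 0 < P.d) {j : ℕ} {ν : ℝ} (hν : 0 < ν)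
    {g : ℝ → ℝ} (hg : ContDiff ℝ ∞ g) (hgper : Function.Periodic g 1)
    (hreal : ∀ c F : ℝ → ℝ → ℝ,
        ContDiffOn ℝ ∞ (Function.uncurry c) (Icc (tStart j) (tStart j + tHalf j) ×ˢ univ) →
        (∀ t ∈ Icc (tStart j) (tStart j + tHalf j), Function.Periodic (c t) 1) →
        (∀ t ∈ Icc (tStart j) (tStart j + tHalf j), ∀ y,
          derivWithin (fun s => c s y) (Icc (tStart j) (tStart j + tHalf j)) t = ν * deriv (deriv (c t)) y) →
        c (tStart j) = g →
        ContDiffOn ℝ ∞ (Function.uncurry F) (Icc (tStart j) (tStart j + tHalf j) ×ˢ univ) →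
        (∀ t ∈ Icc (tStart j) (tStart j + tHalf j), Function.Periodic (F t) 1) → F (tStart j) = (fun _ => 0) →
        (∀ t ∈ Icc (tStart j) (tStart j + tHalf j), ∀ y,
          derivWithin (fun s => F s y) (Icc (tStart j) (tStart j + tHalf j)) t =
            ν * deriv (deriv (F t)) y + ν * (P.rateH j t * deriv (deriv (P.U j)) y)) →
        c (tStart j + tHalf j) = F (tStart j + tHalf j))
    {F : ℝ → ℝ → ℝ} (hF : ContDiffOn ℝ ∞ (Function.uncurry F) (Icc (tStart j) (tStart j + tHalf j) ×ˢ univ))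
    (hFper : ∀ t ∈ Icc (tStart j) (tStart j + tHalf j), Function.Periodic (F t) 1) (hF0 : F (tStart j) = (fun _ => 0))
    (heatF : ∀ t ∈ Icc (tStart j) (tStart j + tHalf j), ∀ y,
      derivWithin (fun s => F s y) (Icc (tStart j) (tStart j + tHalf j)) t =
        ν * deriv (deriv (F t)) y + ν * (P.rateH j t * deriv (deriv (P.U j)) y))
    {W : ℝ → UnitAddTorus (Fin 2) → EuclideanSpace ℝ (Fin 2)} {R : ℝ → UnitAddTorus (Fin 2) → ℝ}
    (hW : Torus.IsSmoothSpaceTimeOn (Icc (tStart j) (tStart j + tHalf j)) W)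
    (hR : Torus.IsSmoothSpaceTimeOn (Icc (tStart j) (tStart j + tHalf j)) R)
    (hWdiv : ∀ t ∈ Icc (tStart j) (tStart j + tHalf j), Torus.IsDivFree (W t))
    (hWlin : ∀ t ∈ Icc (tStart j) (tStart j + tHalf j), ∀ x,
      Torus.timeDerivWithin (Icc (tStart j) (tStart j + tHalf j)) W t x + Torus.convect (P.field t) (W t) x +
        Torus.convect (W t) (P.field t) x = ν • Torus.laplacian (W t) x - Torus.gradient (R t) x)
    (hW0 : W (tStart j) = fun x => g (Torus.repr x 1) • EuclideanSpace.single (0 : Fin 2) (1 : ℝ)) :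
    W (tStart j + tHalf j) =
      fun x => F (tStart j + tHalf j) (Torus.repr x 1) • EuclideanSpace.single (0 : Fin 2) (1 : ℝ) := by
  have hlt : tStart j < tStart j + tHalf j := by linarith [tHalf_pos j]
  have hb : tStart j + tHalf j ∈ Icc (tStart j) (tStart j + tHalf j) := right_mem_Icc.2 hlt.le
  obtain ⟨c, hc, hcper, heatc, hca⟩ := exists_heatProfile hlt hν hg hgper
  have hW0' : W (tStart j) = fun x => c (tStart j) (Torus.repr x 1) • EuclideanSpace.single (0 : Fin 2) (1 : ℝ) := by
    rw [hW0, hca]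
  obtain ⟨heq, -⟩ := parallel_H_unique P hδ₀ hd hν.le hc hcper heatc hW hR hWdiv hWlin hW0' hb
  rw [heq, hreal c F hc hcper heatc hca hF hFper hF0 heatF]

end Summit.AnomalousDissipation.AnomalousDissipation.Theorems.SawtoothPulseCascade.ApproxResponse

end
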